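import Literature.MathematicalPhysics.QuantumFieldTheory.Balaban1983to89.Node00.CriticalOnFibreTangent
import Literature.MathematicalPhysics.QuantumFieldTheory.Balaban1983to89.Node00.CriticalOnFibreB

/-!
# NODE 00 — «`Φ` IS A SUBMERSIVE CHART OF THE CONSTRAINT `Ū = W` ON A **BOND-LEVEL** DATUM `𝐁ᵇ` NEAR `U`» AND «CURVE-CRITICAL ⇒ TANGENT-CRITICAL» OVER A BOND DATUM — the print-datum
# ([Balaban1984PropagatorsII] (2.3)) edition of n07-e's 35a `Node00/CriticalOnFibreTangent` §Local (`IsFibreChartNear`, `hasDerivAt_wilsonAction4_expChart_of_isCritOnFibre_near`), keyed on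
# n07-e's F0b `IsCritOnFibreB`

statement-level skeleton of published theorems with citation tags; proofs where landed; nothing here is a claim about
the Yang–Mills mass gap

Cell `pub-ymgap` (HUMAN RULINGS D-0062 ∕ D-0149), lane `pub-ymgap-dag-n12-c` g35 (R134 seat (a), N12 = [B15], s1, lane owner); `--kind definition --supports` K1⁹ `stmt-QuantumFields-27364`;
count-neutral.  (E1) variant (iii-b), class (γ) of the lane's census-by-declaration (bus [DAGN12C-G35], 2026-08-30): the ONE declaration of 35a that N12's junction of record v14ᴸ uses with a
datum-bearing statement is `hasDerivAt_wilsonAction4_expChart_of_isCritOnFibre_near` (consumed through n07-w2's `Node00/MultiScaleFibreChart`); its hypothesis `IsFibreChartNear F N K 𝔹 …` reads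
the fibre `AgreeOn 𝔹`.  Over print's [II] (2.3) datum the fibre is `AgreeOnB 𝔅` (F0a) and criticality is F0b's `IsCritOnFibreB 𝔅`; this file supplies the matching chart predicate and the
tangent theorem, proofs VERBATIM (35a's implicit-function curve + same-velocity lemma are datum-free and REUSED by name).

HONESTY GUARD (director-ym №338 (5)).  PURELY ADDITIVE: 35a and F0b stay landed and true on their own text; `IsFibreChartNear F N K 𝔹` IS `IsFibreChartNearB F N K (bondsDet 𝔹)` by `Iff.rfl`;
no displayed premise of any consumer is deleted or weakened.  A `Prop` with a body, never asserted.  No `instance`, no `notation`, no `sorry`.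

WHAT IS HERE.  §1 `IsFibreChartNearB` · `isFibreChartNear_iff_isFibreChartNearB` (`Iff.rfl`) · `IsFibreChartNearB.anti` (a chart for MORE constrained bonds is a chart for fewer);
§2 ★★ `hasDerivAt_wilsonAction4_expChart_of_isCritOnFibreB_near` · `deriv_wilsonAction4_expChart_eq_zero_of_isCritOnFibreB_near`.

HONEST SCOPE.  Kernel calculus bookkeeping; nothing of [15] asserted; count-neutral; N12 ∕ N07 NOT discharged; K0⁷ ∕ K1⁹ NOT closed; one finite 𝕋⁴ programme at fixed ε — nothing continuum ∕
ℝ⁴ ∕ OS; the Yang–Mills mass gap (Clay) is NOT proved by any of this.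

References: [15] = [Balaban1985Variational] (3),(5)–(7) p.278, Sect. C (47)–(49) p.285, Prop. 3 p.289, (82)–(83) p.290, (141) p.299, Prop. 8 p.304; [Balaban1985RegularSpaces] (1.113)–(1.114)
pp.95–97; [III] = [Balaban1988Convergent] (2.10)–(2.12) p.256; [II] = [Balaban1984PropagatorsII] (2.3) p.224.
-/

noncomputable section

namespace Literature.MathematicalPhysics.QuantumFieldTheory.Balaban1983to89.Node00

open Filter Topology
open T4Continuum (T4Family)
open B15DeterminingSets B15DeterminingSetsB
open T4AdjointCovarianceUnitary (lieSU expSU coe_expSU mem_lieSU_iff)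
open scoped Matrix.Norms.L2Operator

/-! ## §1  The local submersive-chart predicate over a bond-level datum -/

section LocalB

variable (F : T4Family) (N : ℕ) [NeZero N]

/-- ★ **«`Φ` IS A SUBMERSIVE CHART OF THE CONSTRAINT NEAR `U`» OVER A BOND-LEVEL DATUM `𝐁ᵇ`** — 35a's `IsFibreChartNear` with the level-set clause landing in the fibre `{U′ | AgreeOnB 𝔅 (Ū′^•)
W}` of [II] (2.3) (`𝔅 j ⊆` bonds of `T^{(j)}`): `HasStrictFDerivAt Φ Φ' 0`, `Φ'` onto, and `∀ᶠ X in 𝓝 0, Φ X = Φ 0 → AgreeOnB 𝔅 (Ū(U·exp X)) W`.  The (b)-instance is `𝔅 := bondsDet 𝐁`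
(`isFibreChartNear_iff_isFibreChartNearB`).  A `Prop` with a body, never asserted here. [cite: Balaban1985Variational, (3),(5)–(6) p.278, Sect. C (47)–(49) p.285, Prop. 3 p.289, (82)–(83) p.290; Balaban1985RegularSpaces, (1.113)–(1.114) pp.95–97; Balaban1988Convergent, (2.10)–(2.12) p.256; Balaban1984PropagatorsII, (2.3) p.224] -/
def IsFibreChartNearB (K : ℕ) (𝔅 : BDetSet (F.P K)) (W : MSField (F.P K) (SU N)) (U : GaugeField (F.P K) 0 (SU N))
    {V : Type*} [NormedAddCommGroup V] [NormedSpace ℝ V] [FiniteDimensional ℝ V]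
    (Φ : (PBond (F.P K) 0 → lieSU (Fin N)) → V) (Φ' : (PBond (F.P K) 0 → lieSU (Fin N)) →L[ℝ] V) : Prop :=
  HasStrictFDerivAt Φ Φ' 0 ∧ (Φ' : (PBond (F.P K) 0 → lieSU (Fin N)) →ₗ[ℝ] V).range = ⊤ ∧
    ∀ᶠ X in 𝓝 (0 : PBond (F.P K) 0 → lieSU (Fin N)), Φ X = Φ 0 → AgreeOnB 𝔅 (avgFamily (avOfRecord F N K) (expChart U X)) W

variable {F N}

/-- `IsFibreChartNear F N K 𝔹` IS `IsFibreChartNearB F N K (bondsDet 𝔹)` — definitionally (the (b)-instance). [cite: Balaban1985Variational, (82)–(83) p.290; Balaban1988Convergent, (2.10) p.256] -/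
theorem isFibreChartNear_iff_isFibreChartNearB {K : ℕ} (𝔹 : DetSet (F.P K)) (W : MSField (F.P K) (SU N)) (U : GaugeField (F.P K) 0 (SU N))
    {V : Type*} [NormedAddCommGroup V] [NormedSpace ℝ V] [FiniteDimensional ℝ V]
    (Φ : (PBond (F.P K) 0 → lieSU (Fin N)) → V) (Φ' : (PBond (F.P K) 0 → lieSU (Fin N)) →L[ℝ] V) :
    IsFibreChartNear F N K 𝔹 W U Φ Φ' ↔ IsFibreChartNearB F N K (bondsDet 𝔹) W U Φ Φ' := Iff.rfl

/-- A submersive chart whose level set lands in the fibre of MORE constrained bonds is one for every SMALLER bond datum (`AgreeOnB.anti`). [cite: Balaban1984PropagatorsII, (2.3) p.224; Balaban1988Convergent, (2.10) p.256 (bookkeeping)] -/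
theorem IsFibreChartNearB.anti {K : ℕ} {𝔅₁ 𝔅₂ : BDetSet (F.P K)} (h𝔅 : ∀ j, 𝔅₁ j ⊆ 𝔅₂ j) {W : MSField (F.P K) (SU N)} {U : GaugeField (F.P K) 0 (SU N)}
    {V : Type*} [NormedAddCommGroup V] [NormedSpace ℝ V] [FiniteDimensional ℝ V]
    {Φ : (PBond (F.P K) 0 → lieSU (Fin N)) → V} {Φ' : (PBond (F.P K) 0 → lieSU (Fin N)) →L[ℝ] V}
    (h : IsFibreChartNearB F N K 𝔅₂ W U Φ Φ') : IsFibreChartNearB F N K 𝔅₁ W U Φ Φ' :=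
  ⟨h.1, h.2.1, h.2.2.mono fun _ hX hΦ => (hX hΦ).anti h𝔅⟩

/-! ## §2  Curve-critical ⇒ tangent-critical over a bond datum, local chart -/

/-- ★★ **CURVE-CRITICAL ⇒ TANGENT-CRITICAL OVER A BOND-LEVEL DATUM, LOCAL CHART**: if `U` is a critical configuration of (5) on the fibre `{AgreeOnB 𝔅 (Ū ·) W}` in the CURVE form (F0b
`IsCritOnFibreB`) and `Φ` is a local submersive chart of that constraint (`IsFibreChartNearB`), then `d∕dt A(U·exp(tX))∣_{t=0} = 0` for every kernel direction `X` of `Φ'`; 35a's proof VERBATIM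
(implicit-function curve `exists_hasDerivAt_curve_of_mem_ker`, `hasDerivAt_wilsonAction4_of_sameVelocity`).  At `𝔅 := lamBondsSeq s.Ω k` this is print's (82) on the tangent space (83) of the
[II] (2.3) fibre. [cite: Balaban1985Variational, Sect. C (47) p.285, Prop. 3 p.289, (82)–(83) p.290, (141) p.299, p.300, Prop. 8 p.304; Balaban1985RegularSpaces, (1.113)–(1.114) pp.95–97; Balaban1984PropagatorsII, (2.3) p.224] -/
theorem hasDerivAt_wilsonAction4_expChart_of_isCritOnFibreB_near {K : ℕ} {𝔅 : BDetSet (F.P K)} {W : MSField (F.P K) (SU N)}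
    {U : GaugeField (F.P K) 0 (SU N)} {V : Type*} [NormedAddCommGroup V] [NormedSpace ℝ V] [FiniteDimensional ℝ V]
    {Φ : (PBond (F.P K) 0 → lieSU (Fin N)) → V} {Φ' : (PBond (F.P K) 0 → lieSU (Fin N)) →L[ℝ] V}
    (hΦ : IsFibreChartNearB F N K 𝔅 W U Φ Φ') (hcrit : IsCritOnFibreB F N K 𝔅 W U)
    {X : PBond (F.P K) 0 → lieSU (Fin N)} (hX : Φ' X = 0) :
    HasDerivAt (fun t : ℝ => wilsonAction4 (expChart U (t • X))) 0 0 := by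
  haveI : @CompleteSpace (lieSU (Fin N)) (@PseudoMetricSpace.toUniformSpace _
      (T4AdjointCovarianceUnitary.instSeminormedAddCommGroupLieSU (n := Fin N)).toPseudoMetricSpace) :=
    complete_of_proper
  obtain ⟨c, hc0, hcX, hcf⟩ := exists_hasDerivAt_curve_of_mem_ker hΦ.1 hΦ.2.1 hX
  have h₁ : ∀ b, HasDerivAt (fun t => ((expChart U (c t) b : SU N) : Matrix (Fin N) (Fin N) ℂ))
      ((U b : Matrix (Fin N) (Fin N) ℂ) * (X b : Matrix (Fin N) (Fin N) ℂ)) 0 :=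
    hasDerivAt_coe_expChart_along hcX hc0
  have h₂ : ∀ b, HasDerivAt (fun t : ℝ => ((expChart U (t • X) b : SU N) : Matrix (Fin N) (Fin N) ℂ))
      ((U b : Matrix (Fin N) (Fin N) ℂ) * (X b : Matrix (Fin N) (Fin N) ℂ)) 0 :=
    hasDerivAt_coe_expChart_along (U := U) (c := fun t : ℝ => t • X) (hasDerivAt_ray X) (zero_smul ℝ X)
  have h12 : (fun t => expChart U (c t)) 0 = (fun t : ℝ => expChart U (t • X)) 0 := by
    show expChart U (c 0) = expChart U ((0 : ℝ) • X)
    rw [hc0, zero_smul]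
  have hγ0 : (fun t => expChart U (c t)) 0 = U := by
    show expChart U (c 0) = U
    rw [hc0, expChart_zero]
  have hct : Tendsto c (𝓝 0) (𝓝 0) := by
    have h : Tendsto c (𝓝 0) (𝓝 (c 0)) := hcX.continuousAt.tendsto
    rwa [hc0] at h
  have hfib : ∀ᶠ t in 𝓝 (0 : ℝ), AgreeOnB 𝔅 (avgFamily (avOfRecord F N K) ((fun t => expChart U (c t)) t)) W :=
    (hct.eventually hΦ.2.2).mp (hcf.mono fun t ht h => h ht)
  have hd : DifferentiableAt ℝ
      (fun (t : ℝ) (b : PBond (F.P K) 0) => (((fun t => expChart U (c t)) t b : SU N) : Matrix (Fin N) (Fin N) ℂ)) 0 :=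
    differentiableAt_coe_expChart_along hcX hc0
  have ha := hasDerivAt_wilsonAction4 h₁ (fun p => hasDerivAt_coe_plaqHol h₁ p)
  have ha0 := hcrit (fun t => expChart U (c t)) hγ0 hd hfib _ ha
  rw [ha0] at ha
  exact hasDerivAt_wilsonAction4_of_sameVelocity h12 h₁ h₂ ha

/-- The same with the conclusion as `deriv … 0 = 0` (local chart, bond datum). [cite: Balaban1985Variational, (82) p.290 (bookkeeping)] -/
theorem deriv_wilsonAction4_expChart_eq_zero_of_isCritOnFibreB_near {K : ℕ} {𝔅 : BDetSet (F.P K)} {W : MSField (F.P K) (SU N)}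
    {U : GaugeField (F.P K) 0 (SU N)} {V : Type*} [NormedAddCommGroup V] [NormedSpace ℝ V] [FiniteDimensional ℝ V]
    {Φ : (PBond (F.P K) 0 → lieSU (Fin N)) → V} {Φ' : (PBond (F.P K) 0 → lieSU (Fin N)) →L[ℝ] V}
    (hΦ : IsFibreChartNearB F N K 𝔅 W U Φ Φ') (hcrit : IsCritOnFibreB F N K 𝔅 W U)
    {X : PBond (F.P K) 0 → lieSU (Fin N)} (hX : Φ' X = 0) :
    deriv (fun t : ℝ => wilsonAction4 (expChart U (t • X))) 0 = 0 :=
  (hasDerivAt_wilsonAction4_expChart_of_isCritOnFibreB_near hΦ hcrit hX).deriv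

end LocalB

end Literature.MathematicalPhysics.QuantumFieldTheory.Balaban1983to89.Node00

end
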